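import Mathlib
import HarnessLib
import Literature.Probability.LatticeModels.AnisotropicTorusSum

/-!
# Route `KLProgramme` — engine support (route (L2), ADDITIVE weight): dyadic shells with a CUBIC count, the power-mean step, and the
# time / near-frame / far-isotropic lattice counts on the space-time torus `(ℤ/Pℤ)¹ × (ℤ/Lℤ)²`

Cell `gate-hubbard-kl`, seat hubbard-kl-k3c2-p3 (row «sector-counting import (DR2000 L11/L12) for the leg-dress bar»), for the ENGINE child
stmt-HubbardSuperconductivity-19823 (`stub_engine_step_norms`: the propagator constant `α_n` = row/column `ℓ¹` sums of the sectorised slice covariance,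
and the sector-multiplier overlap size `B` of HOME/prover-p4/FRAME-L22-NOTE.md §2).  The pieces of the proof that the inverse of the ADDITIVE
quartic weight `W(j,z) = 1 + (s₀|j̃|)⁴ + (s₁|z̃₁|)⁴ + (s₁|z̃₂|)⁴ + (s₂|ã_{v⊥}(z)|)⁴ + (s₃|ã_v(z)|)⁴` is summable uniformly in `(P, L)`
(`KLProgrammeKLRegimeTorusAdditiveWeightSum.lean`):

* **`sum_inv_pow_le_of_card_le_cubic`** — dyadic shells: on a finite set, `f ≥ R_min ≥ 1` and `#{f ≤ R} ≤ A·R³` (`R ≥ 1`) give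
  `Σ f⁻ᵐ ≤ 32·A/R_min` for `m ≥ 4` (the cubic-count twin of `AnisotropicLatticeSum.sum_inv_pow_le_of_card_le`);
* `one_add_three_pow_four_le`, **`inv_one_add_quartic_le`** — `(1 + a⁴ + b⁴ + c⁴)⁻¹ ≤ 64·(1 + a + b + c)⁻⁴` (power mean);
* `card_filter_time_le` (`#{s|j̃| ≤ R} ≤ 4(1/s+1)R`), `card_filter_prod_and_le`, **`card_filter_frame_near_le`**
  (`#{s₂|v⊥·z̃| ≤ R, s₃|v·z̃| ≤ R} ≤ (2√2/(s₂|v|)+2)(2√2/(s₃|v|)+2)·R²`, the rotated-box count through the injective centred coordinates).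

Everything is proved; no definitions, no named facts. [folklore]

References: G. Benfatto, A. Giuliani, V. Mastropietro, Ann. Henri Poincaré 7 (2006) 809–898, §2.6 (2.81), Lemma 2.2 and footnote ¹.
-/

noncomputable section

namespace Summit.HubbardSuperconductivity.HubbardSuperconductivity.Theorems.TorusFourierL2

set_option linter.dupNamespace false -- summit = problem name (single-conjunct summit), D-0017

open Finset Literature.Probability.LatticeModels
open scoped Real

/-! ### §1 Dyadic shells with a cubic count -/

/-- Geometric tail over a finite set of exponents bounded below: `Σ_{k ∈ S} (1/2)^k ≤ 2·(1/2)^{k₀}` if `k₀ ≤ k` on `S`. [folklore] -/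
theorem sum_half_pow_le_of_le (S : Finset ℕ) (k₀ : ℕ) (hS : ∀ k ∈ S, k₀ ≤ k) :
    ∑ k ∈ S, (1 / 2 : ℝ) ^ k ≤ 2 * (1 / 2 : ℝ) ^ k₀ := by
  have hinj : Set.InjOn (fun k => k - k₀) S := by
    intro a ha b hb h
    have := hS a ha; have := hS b hb
    simp only at h; omega
  have hshift : ∀ k ∈ S, (1 / 2 : ℝ) ^ k = (1 / 2 : ℝ) ^ k₀ * (1 / 2 : ℝ) ^ (k - k₀) := fun k hk => by
    rw [← pow_add, Nat.add_sub_cancel' (hS k hk)]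
  rw [sum_congr rfl hshift, ← mul_sum, mul_comm]
  refine mul_le_mul_of_nonneg_right ?_ (by positivity)
  rw [← Finset.sum_image hinj]
  calc ∑ i ∈ S.image (fun k => k - k₀), (1 / 2 : ℝ) ^ i ≤ ∑' i : ℕ, (1 / 2 : ℝ) ^ i :=
        summable_geometric_two.sum_le_tsum _ (fun i _ => by positivity)
    _ = 2 := tsum_geometric_two

/-- **Dyadic shells with a CUBIC count and a floor**: on a finite set `S` let `f ≥ R_min ≥ 1` with `#{z ∈ S : f z ≤ R} ≤ A·R³` for all `R ≥ 1`;
then `Σ_{z ∈ S} (f z)⁻ᵐ ≤ 32·A/R_min` for every `m ≥ 4` (the quartic decay beats the cubic count by a geometric series starting at the scale of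
`R_min`). [folklore] -/
theorem sum_inv_pow_le_of_card_le_cubic {α : Type*} [DecidableEq α] (S : Finset α) (f : α → ℝ) {Rmin : ℝ} (hRmin : 1 ≤ Rmin)
    (hf : ∀ z ∈ S, Rmin ≤ f z) {A : ℝ} (hA : 0 ≤ A)
    (hcount : ∀ R : ℝ, 1 ≤ R → (((S.filter fun z => f z ≤ R).card : ℕ) : ℝ) ≤ A * R ^ 3) {m : ℕ} (hm : 4 ≤ m) :
    ∑ z ∈ S, (f z)⁻¹ ^ m ≤ 32 * A / Rmin := by
  classical
  have hf1 : ∀ z ∈ S, 1 ≤ f z := fun z hz => hRmin.trans (hf z hz)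
  -- the dyadic scale of each point
  set j : α → ℕ := fun z => Nat.log 2 ⌊f z⌋₊ with hj
  have hlow : ∀ z ∈ S, (2 : ℝ) ^ (j z) ≤ f z := fun z hz => by
    have hfloor : 1 ≤ ⌊f z⌋₊ := Nat.le_floor (by exact_mod_cast hf1 z hz)
    have h := Nat.pow_log_le_self 2 (Nat.one_le_iff_ne_zero.1 hfloor)
    calc (2 : ℝ) ^ (j z) = ((2 ^ Nat.log 2 ⌊f z⌋₊ : ℕ) : ℝ) := by push_cast; rfl
      _ ≤ (⌊f z⌋₊ : ℝ) := by exact_mod_cast h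
      _ ≤ f z := Nat.floor_le (zero_le_one.trans (hf1 z hz))
  have hup : ∀ z, f z ≤ (2 : ℝ) ^ (j z + 1) := fun z => by
    have h := Nat.lt_pow_succ_log_self (b := 2) one_lt_two ⌊f z⌋₊
    have h' : (⌊f z⌋₊ : ℝ) + 1 ≤ ((2 ^ (Nat.log 2 ⌊f z⌋₊ + 1) : ℕ) : ℝ) := by exact_mod_cast h
    calc f z ≤ (⌊f z⌋₊ : ℝ) + 1 := (Nat.lt_floor_add_one (f z)).le
      _ ≤ ((2 ^ (Nat.log 2 ⌊f z⌋₊ + 1) : ℕ) : ℝ) := h'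
      _ = (2 : ℝ) ^ (j z + 1) := by push_cast; rfl
  -- the least scale: `k₀ = log₂ ⌊R_min⌋`, with `(1/2)^{k₀} ≤ 2/R_min` and `k₀ ≤ j z`
  set k₀ : ℕ := Nat.log 2 ⌊Rmin⌋₊ with hk₀
  have hk₀j : ∀ z ∈ S, k₀ ≤ j z := fun z hz =>
    Nat.log_mono_right (Nat.floor_le_floor (hf z hz))
  have hk₀R : (1 / 2 : ℝ) ^ k₀ ≤ 2 / Rmin := by
    have h := Nat.lt_pow_succ_log_self (b := 2) one_lt_two ⌊Rmin⌋₊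
    have h' : (⌊Rmin⌋₊ : ℝ) + 1 ≤ ((2 ^ (k₀ + 1) : ℕ) : ℝ) := by exact_mod_cast h
    have hR2 : Rmin ≤ 2 * (2 : ℝ) ^ k₀ := by
      calc Rmin ≤ (⌊Rmin⌋₊ : ℝ) + 1 := (Nat.lt_floor_add_one Rmin).le
        _ ≤ ((2 ^ (k₀ + 1) : ℕ) : ℝ) := h'
        _ = 2 * (2 : ℝ) ^ k₀ := by push_cast; ring
    have hpos : (0 : ℝ) < (2 : ℝ) ^ k₀ := by positivity
    rw [one_div, inv_pow, inv_le_comm₀ hpos (by positivity : (0:ℝ) < 2 / Rmin), inv_div]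
    rw [div_le_iff₀ (by norm_num : (0:ℝ) < 2)]
    linarith
  -- termwise: `f^{-m} ≤ (2^{-j})^4 = (1/2)^j · 8^{-j}`
  have hterm : ∀ z ∈ S, (f z)⁻¹ ^ m ≤ (1 / 2 : ℝ) ^ (j z) * ((8 : ℝ) ^ (j z))⁻¹ := fun z hz => by
    have h0 : 0 ≤ (f z)⁻¹ := inv_nonneg.2 (zero_le_one.trans (hf1 z hz))
    have hle1 : ((2 : ℝ) ^ (j z))⁻¹ ≤ 1 := inv_le_one_of_one_le₀ (one_le_pow₀ (by norm_num))
    calc (f z)⁻¹ ^ m ≤ ((2 : ℝ) ^ (j z))⁻¹ ^ m := pow_le_pow_left₀ h0 (inv_anti₀ (by positivity) (hlow z hz)) m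
      _ ≤ ((2 : ℝ) ^ (j z))⁻¹ ^ 4 := pow_le_pow_of_le_one (by positivity) hle1 hm
      _ = (1 / 2 : ℝ) ^ (j z) * ((8 : ℝ) ^ (j z))⁻¹ := by
          rw [show (8 : ℝ) = 2 ^ 3 by norm_num, ← pow_mul, one_div, ← inv_pow, ← inv_pow, ← pow_mul, ← pow_add]
          congr 1; ring
  -- group by the dyadic scale
  have hfib : ∑ z ∈ S, (1 / 2 : ℝ) ^ (j z) * ((8 : ℝ) ^ (j z))⁻¹ =
      ∑ k ∈ S.image j, ((S.filter fun z => j z = k).card : ℝ) * ((1 / 2 : ℝ) ^ k * ((8 : ℝ) ^ k)⁻¹) := by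
    rw [Finset.sum_comp (fun k : ℕ => (1 / 2 : ℝ) ^ k * ((8 : ℝ) ^ k)⁻¹) j]
    simp only [nsmul_eq_mul]
  have hcardk : ∀ k : ℕ, (((S.filter fun z => j z = k).card : ℕ) : ℝ) ≤ A * 8 * (8 : ℝ) ^ k := by
    intro k
    have hsub : (S.filter fun z => j z = k) ⊆ S.filter fun z => f z ≤ (2 : ℝ) ^ (k + 1) := by
      intro z hz
      simp only [mem_filter] at hz ⊢
      refine ⟨hz.1, ?_⟩
      calc f z ≤ (2 : ℝ) ^ (j z + 1) := hup z
        _ = (2 : ℝ) ^ (k + 1) := by rw [hz.2]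
    have h1 : (((S.filter fun z => j z = k).card : ℕ) : ℝ) ≤ (((S.filter fun z => f z ≤ (2 : ℝ) ^ (k + 1)).card : ℕ) : ℝ) := by
      exact_mod_cast card_le_card hsub
    have h2 := hcount ((2 : ℝ) ^ (k + 1)) (one_le_pow₀ (by norm_num))
    have h3 : A * ((2 : ℝ) ^ (k + 1)) ^ 3 = A * 8 * (8 : ℝ) ^ k := by
      rw [← pow_mul, show (k + 1) * 3 = 3 * k + 3 by ring, pow_add, pow_mul]; norm_num; ring
    linarith
  have hgeosum : ∑ k ∈ S.image j, (1 / 2 : ℝ) ^ k ≤ 2 * (2 / Rmin) := by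
    refine (sum_half_pow_le_of_le (S.image j) k₀ fun k hk => ?_).trans (by linarith [hk₀R])
    obtain ⟨z, hz, rfl⟩ := mem_image.1 hk
    exact hk₀j z hz
  calc ∑ z ∈ S, (f z)⁻¹ ^ m ≤ ∑ z ∈ S, (1 / 2 : ℝ) ^ (j z) * ((8 : ℝ) ^ (j z))⁻¹ := sum_le_sum hterm
    _ = ∑ k ∈ S.image j, ((S.filter fun z => j z = k).card : ℝ) * ((1 / 2 : ℝ) ^ k * ((8 : ℝ) ^ k)⁻¹) := hfib
    _ ≤ ∑ k ∈ S.image j, (A * 8 * (8 : ℝ) ^ k) * ((1 / 2 : ℝ) ^ k * ((8 : ℝ) ^ k)⁻¹) :=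
        sum_le_sum fun k _ => mul_le_mul_of_nonneg_right (hcardk k) (by positivity)
    _ = 8 * A * ∑ k ∈ S.image j, (1 / 2 : ℝ) ^ k := by
        rw [mul_sum]
        refine sum_congr rfl fun k _ => ?_
        have h8 : (8 : ℝ) ^ k ≠ 0 := by positivity
        field_simp
    _ ≤ 8 * A * (2 * (2 / Rmin)) := mul_le_mul_of_nonneg_left hgeosum (by positivity)
    _ = 32 * A / Rmin := by ring

/-! ### §2 The power-mean step: additive quartic weight versus the fourth power of the sum -/

/-- `(1 + a + b + c)⁴ ≤ 64·(1 + a⁴ + b⁴ + c⁴)` for `a, b, c ≥ 0` (Jensen / power mean with four terms). [folklore] -/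
theorem one_add_three_pow_four_le {a b c : ℝ} (ha : 0 ≤ a) (hb : 0 ≤ b) (hc : 0 ≤ c) :
    (1 + a + b + c) ^ 4 ≤ 64 * (1 + a ^ 4 + b ^ 4 + c ^ 4) := by
  have h := pow_sum_le_card_mul_sum_pow (s := (univ : Finset (Fin 4))) (f := ![1, a, b, c])
    (fun i _ => by fin_cases i <;> simp [ha, hb, hc]) 3
  simp only [Fin.sum_univ_four, Finset.card_univ, Fintype.card_fin] at h
  simp only [Matrix.cons_val_zero, Matrix.cons_val_one, Matrix.cons_val] at h
  norm_num at h
  linarith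

/-- **The additive quartic weight dominates the fourth power of the sum**: `(1 + a⁴ + b⁴ + c⁴)⁻¹ ≤ 64·((1 + a + b + c)⁻¹)⁴`. [folklore] -/
theorem inv_one_add_quartic_le {a b c : ℝ} (ha : 0 ≤ a) (hb : 0 ≤ b) (hc : 0 ≤ c) :
    (1 + a ^ 4 + b ^ 4 + c ^ 4)⁻¹ ≤ 64 * (1 + a + b + c)⁻¹ ^ 4 := by
  have h := one_add_three_pow_four_le ha hb hc
  have hpos : 0 < 1 + a ^ 4 + b ^ 4 + c ^ 4 := by positivity
  have hpos' : 0 < (1 + a + b + c) ^ 4 := by positivity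
  rw [inv_pow, ← div_eq_mul_inv, le_div_iff₀ hpos', inv_mul_le_iff₀ hpos]
  linarith

/-! ### §3 Counting: time slices, the near frame box, the far isotropic box -/

/-- Time slices: `#{j ∈ (ℤ/Pℤ)¹ : s|j̃| ≤ R} ≤ 4(1/s + 1)·R` for `R ≥ 1`, `s > 0`. [folklore] -/
theorem card_filter_time_le {P : ℕ} [NeZero P] {s : ℝ} (hs : 0 < s) {R : ℝ} (hR : 1 ≤ R) :
    (((univ.filter fun j : TorusSite 1 P => s * |(((j 0).valMinAbs : ℤ) : ℝ)| ≤ R).card : ℕ) : ℝ) ≤ 4 * (1 / s + 1) * R := by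
  have hsep : ∀ a b : TorusSite 1 P, |(((a 0).valMinAbs : ℤ) : ℝ) - (((b 0).valMinAbs : ℤ) : ℝ)| < 1 →
      |(0 : ℝ) - 0| < 1 → a = b := by
    intro a b h _
    exact funext fun i => by rw [Subsingleton.elim i 0]; exact valMinAbs_eq_of_abs_sub_lt _ _ h
  have hcount := card_filter_abs_le_le_of_separated (fun j : TorusSite 1 P => (((j 0).valMinAbs : ℤ) : ℝ))
    (fun _ => (0 : ℝ)) one_pos hsep (div_nonneg (zero_le_one.trans hR) hs.le : (0 : ℝ) ≤ R / s) le_rfl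
  have hsub : (univ.filter fun j : TorusSite 1 P => s * |(((j 0).valMinAbs : ℤ) : ℝ)| ≤ R) ⊆
      univ.filter fun j : TorusSite 1 P => |(((j 0).valMinAbs : ℤ) : ℝ)| ≤ R / s ∧ |(0 : ℝ)| ≤ 0 := by
    intro j hj
    have h := (mem_filter.1 hj).2
    refine mem_filter.2 ⟨mem_univ _, ?_, by simp⟩
    rw [le_div_iff₀ hs]; linarith
  calc (((univ.filter fun j : TorusSite 1 P => s * |(((j 0).valMinAbs : ℤ) : ℝ)| ≤ R).card : ℕ) : ℝ)
      ≤ (((univ.filter fun j : TorusSite 1 P => |(((j 0).valMinAbs : ℤ) : ℝ)| ≤ R / s ∧ |(0 : ℝ)| ≤ 0).card : ℕ) : ℝ) := by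
        exact_mod_cast card_le_card hsub
    _ ≤ (2 * (R / s) / 1 + 2) * (2 * 0 / 1 + 2) := hcount
    _ = 4 * (R / s + 1) := by ring
    _ ≤ 4 * (1 / s + 1) * R := by
        have : R / s + 1 ≤ (1 / s + 1) * R := by rw [add_mul, one_div, inv_mul_eq_div]; linarith
        linarith

/-- A filter on a product type by a conjunction of one-sided predicates is at most the product of the one-sided counts. [folklore] -/
theorem card_filter_prod_and_le {α β : Type*} [Fintype α] [Fintype β] (p : α → Prop) (q : β → Prop)
    [DecidablePred p] [DecidablePred q] (r : α × β → Prop) [DecidablePred r] (hr : ∀ x, r x → p x.1 ∧ q x.2) :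
    (univ.filter r).card ≤ (univ.filter p).card * (univ.filter q).card := by
  classical
  calc (univ.filter r).card ≤ ((univ ×ˢ univ).filter fun x : α × β => p x.1 ∧ q x.2).card := by
        refine card_le_card fun x hx => ?_
        rw [mem_filter] at hx ⊢
        exact ⟨mem_product.2 ⟨mem_univ _, mem_univ _⟩, hr x hx.2⟩
    _ = (univ.filter p).card * (univ.filter q).card := by rw [filter_product, card_product]

/-- **The near frame box** (over the whole torus): for an integer vector `v ≠ 0` (`|v| = √(v₁²+v₂²)`), rates `s₂, s₃ > 0` and `R ≥ 1`,
`#{z : s₂|v⊥·z̃| ≤ R, s₃|v·z̃| ≤ R} ≤ (2√2/(s₂|v|) + 2)(2√2/(s₃|v|) + 2)·R²`, where `v⊥·z̃`, `v·z̃` are the frame coordinates of the centred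
representative `z̃ ∈ ℤ²` (injective in `z`; `(v⊥, v)/|v|` is an orthonormal frame, so frame coordinates closer than `1/√2` force equality).
[folklore] -/
theorem card_filter_frame_near_le {L : ℕ} [NeZero L] (v : Fin 2 → ℤ) (hv : v ≠ 0)
    {s₂ s₃ : ℝ} (hs₂ : 0 < s₂) (hs₃ : 0 < s₃) {R : ℝ} (hR : 1 ≤ R) :
    (((univ.filter fun z : TorusSite 2 L =>
        s₂ * |(-(v 1 : ℝ)) * (((z 0).valMinAbs : ℤ) : ℝ) + (v 0 : ℝ) * (((z 1).valMinAbs : ℤ) : ℝ)| ≤ R ∧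
        s₃ * |(v 0 : ℝ) * (((z 0).valMinAbs : ℤ) : ℝ) + (v 1 : ℝ) * (((z 1).valMinAbs : ℤ) : ℝ)| ≤ R).card : ℕ) : ℝ) ≤
      ((2 * Real.sqrt 2 / (s₂ * Real.sqrt ((v 0 : ℝ) ^ 2 + (v 1 : ℝ) ^ 2)) + 2) *
        (2 * Real.sqrt 2 / (s₃ * Real.sqrt ((v 0 : ℝ) ^ 2 + (v 1 : ℝ) ^ 2)) + 2)) * R ^ 2 := by
  classical
  -- `|v| > 0` and the orthonormal frame `n = v⊥/|v|`, `τ = v/|v|`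
  have hv2 : (0 : ℝ) < (v 0 : ℝ) ^ 2 + (v 1 : ℝ) ^ 2 := by
    by_contra h
    have h0 : (v 0 : ℝ) = 0 := by nlinarith [sq_nonneg (v 0 : ℝ), sq_nonneg (v 1 : ℝ)]
    have h1 : (v 1 : ℝ) = 0 := by nlinarith [sq_nonneg (v 0 : ℝ), sq_nonneg (v 1 : ℝ)]
    have h0' : v 0 = 0 := by exact_mod_cast h0
    have h1' : v 1 = 0 := by exact_mod_cast h1
    exact hv (funext fun i => by fin_cases i <;> assumption)
  set r : ℝ := Real.sqrt ((v 0 : ℝ) ^ 2 + (v 1 : ℝ) ^ 2) with hr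
  have hrpos : 0 < r := Real.sqrt_pos.2 hv2
  have hrsq : r ^ 2 = (v 0 : ℝ) ^ 2 + (v 1 : ℝ) ^ 2 := Real.sq_sqrt hv2.le
  set n : Fin 2 → ℝ := ![-(v 1 : ℝ) / r, (v 0 : ℝ) / r] with hn
  set τ : Fin 2 → ℝ := ![(v 0 : ℝ) / r, (v 1 : ℝ) / r] with hτ
  have hn0 : n 0 = -(v 1 : ℝ) / r := rfl
  have hn1' : n 1 = (v 0 : ℝ) / r := rfl
  have hτ0 : τ 0 = (v 0 : ℝ) / r := rfl
  have hτ1' : τ 1 = (v 1 : ℝ) / r := rfl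
  have hn1 : n 0 ^ 2 + n 1 ^ 2 = 1 := by rw [hn0, hn1']; field_simp; linarith [hrsq]
  have hτ1 : τ 0 ^ 2 + τ 1 ^ 2 = 1 := by rw [hτ0, hτ1']; field_simp; linarith [hrsq]
  have hnτ : n 0 * τ 0 + n 1 * τ 1 = 0 := by rw [hn0, hn1', hτ0, hτ1']; field_simp; ring
  -- the frame coordinates of the centred representative
  set X : TorusSite 2 L → ℝ := fun z => (((z 0).valMinAbs : ℤ) : ℝ) * n 0 + (((z 1).valMinAbs : ℤ) : ℝ) * n 1 with hX
  set Y : TorusSite 2 L → ℝ := fun z => (((z 0).valMinAbs : ℤ) : ℝ) * τ 0 + (((z 1).valMinAbs : ℤ) : ℝ) * τ 1 with hY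
  have hs2 : (0 : ℝ) < Real.sqrt 2 := Real.sqrt_pos.2 two_pos
  have hs2sq : Real.sqrt 2 ^ 2 = 2 := Real.sq_sqrt two_pos.le
  have hδ : (0 : ℝ) < (Real.sqrt 2)⁻¹ := inv_pos.2 hs2
  -- separation: frame coordinates closer than `1/√2` force equality
  have hsep : ∀ a b : TorusSite 2 L, |X a - X b| < (Real.sqrt 2)⁻¹ → |Y a - Y b| < (Real.sqrt 2)⁻¹ → a = b := by
    intro a b hXab hYab
    set u : Fin 2 → ℝ := ![(((a 0).valMinAbs : ℤ) : ℝ) - (((b 0).valMinAbs : ℤ) : ℝ),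
      (((a 1).valMinAbs : ℤ) : ℝ) - (((b 1).valMinAbs : ℤ) : ℝ)] with hu
    have hX' : |u 0 * n 0 + u 1 * n 1| < (Real.sqrt 2)⁻¹ := by
      convert hXab using 2; simp [hu, hX]; ring
    have hY' : |u 0 * τ 0 + u 1 * τ 1| < (Real.sqrt 2)⁻¹ := by
      convert hYab using 2; simp [hu, hY]; ring
    have hA := sq_lt_sq' (abs_lt.1 hX').1 (abs_lt.1 hX').2
    have hB := sq_lt_sq' (abs_lt.1 hY').1 (abs_lt.1 hY').2
    have hsum : u 0 ^ 2 + u 1 ^ 2 < 1 := by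
      have h2inv : ((Real.sqrt 2)⁻¹) ^ 2 = 2⁻¹ := by rw [inv_pow, hs2sq]
      rw [h2inv] at hA hB
      rw [← frame_sq_add_sq_eq hn1 hτ1 hnτ u]
      linarith
    have h0 : u 0 ^ 2 < 1 := by nlinarith [sq_nonneg (u 1)]
    have h1 : u 1 ^ 2 < 1 := by nlinarith [sq_nonneg (u 0)]
    have e0 : |(((a 0).valMinAbs : ℤ) : ℝ) - (((b 0).valMinAbs : ℤ) : ℝ)| < 1 := by
      have := (sq_lt_one_iff_abs_lt_one (u 0)).1 h0; simpa [hu] using this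
    have e1 : |(((a 1).valMinAbs : ℤ) : ℝ) - (((b 1).valMinAbs : ℤ) : ℝ)| < 1 := by
      have := (sq_lt_one_iff_abs_lt_one (u 1)).1 h1; simpa [hu] using this
    exact funext fun i => by
      fin_cases i
      · exact valMinAbs_eq_of_abs_sub_lt _ _ e0
      · exact valMinAbs_eq_of_abs_sub_lt _ _ e1
  have hR1 : 0 ≤ R / (s₂ * r) := by positivity
  have hR2 : 0 ≤ R / (s₃ * r) := by positivity
  have hcount := card_filter_abs_le_le_of_separated X Y hδ hsep hR1 hR2
  -- the filtered set is inside the frame box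
  have k1 : ∀ z : TorusSite 2 L, r * X z =
      (-(v 1 : ℝ)) * (((z 0).valMinAbs : ℤ) : ℝ) + (v 0 : ℝ) * (((z 1).valMinAbs : ℤ) : ℝ) := fun z => by
    simp only [hX, hn0, hn1']; field_simp
  have k2 : ∀ z : TorusSite 2 L, r * Y z =
      (v 0 : ℝ) * (((z 0).valMinAbs : ℤ) : ℝ) + (v 1 : ℝ) * (((z 1).valMinAbs : ℤ) : ℝ) := fun z => by
    simp only [hY, hτ0, hτ1']; field_simp
  have hsub : (univ.filter fun z : TorusSite 2 L =>
        s₂ * |(-(v 1 : ℝ)) * (((z 0).valMinAbs : ℤ) : ℝ) + (v 0 : ℝ) * (((z 1).valMinAbs : ℤ) : ℝ)| ≤ R ∧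
        s₃ * |(v 0 : ℝ) * (((z 0).valMinAbs : ℤ) : ℝ) + (v 1 : ℝ) * (((z 1).valMinAbs : ℤ) : ℝ)| ≤ R) ⊆
      univ.filter fun z => |X z| ≤ R / (s₂ * r) ∧ |Y z| ≤ R / (s₃ * r) := by
    intro z hz
    obtain ⟨h1, h2⟩ := (mem_filter.1 hz).2
    rw [← k1 z, abs_mul, abs_of_pos hrpos] at h1
    rw [← k2 z, abs_mul, abs_of_pos hrpos] at h2
    refine mem_filter.2 ⟨mem_univ _, ?_, ?_⟩
    · rw [le_div_iff₀ (mul_pos hs₂ hrpos)]; linarith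
    · rw [le_div_iff₀ (mul_pos hs₃ hrpos)]; linarith
  have hfac : ∀ {s : ℝ}, 0 < s → 2 * (R / (s * r)) / (Real.sqrt 2)⁻¹ + 2 ≤ (2 * Real.sqrt 2 / (s * r) + 2) * R := by
    intro s hs
    rw [div_inv_eq_mul]
    have hsr : 0 < s * r := mul_pos hs hrpos
    have : 2 * (R / (s * r)) * Real.sqrt 2 = 2 * Real.sqrt 2 / (s * r) * R := by field_simp
    rw [this, add_mul]
    linarith
  calc (((univ.filter fun z : TorusSite 2 L =>
        s₂ * |(-(v 1 : ℝ)) * (((z 0).valMinAbs : ℤ) : ℝ) + (v 0 : ℝ) * (((z 1).valMinAbs : ℤ) : ℝ)| ≤ R ∧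
        s₃ * |(v 0 : ℝ) * (((z 0).valMinAbs : ℤ) : ℝ) + (v 1 : ℝ) * (((z 1).valMinAbs : ℤ) : ℝ)| ≤ R).card : ℕ) : ℝ)
      ≤ (((univ.filter fun z => |X z| ≤ R / (s₂ * r) ∧ |Y z| ≤ R / (s₃ * r)).card : ℕ) : ℝ) := by
        exact_mod_cast card_le_card hsub
    _ ≤ (2 * (R / (s₂ * r)) / (Real.sqrt 2)⁻¹ + 2) * (2 * (R / (s₃ * r)) / (Real.sqrt 2)⁻¹ + 2) := hcount
    _ ≤ ((2 * Real.sqrt 2 / (s₂ * r) + 2) * R) * ((2 * Real.sqrt 2 / (s₃ * r) + 2) * R) :=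
        mul_le_mul (hfac hs₂) (hfac hs₃) (by positivity) (by positivity)
    _ = _ := by ring

end Summit.HubbardSuperconductivity.HubbardSuperconductivity.Theorems.TorusFourierL2

end
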